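import Literature.Analysis.FluidPDE.TorusNSTimeDerivDifference
import HarnessLib

/-!
# Additivity of the smooth Leray–Helmholtz projection and of the linearisation `w ↦ DG(u)[w]`

Analysis/FluidPDE proof file (theorems only; no definitions, no named facts), companion of
`TorusNSTimeDerivDifference.lean`.  For the smooth Leray–Helmholtz projection `P v = v − ∇Δ⁻¹div v`
(`TorusLerayHelmholtzH1.lean`) and the linearisation `DG(u)[w] = P(νΔw − (u·∇)w − (w·∇)u)` of the projected
Navier–Stokes vector field we record the pointwise identities `P(A + B) = P A + P B` (`Torus.leray_add_apply`) and
`DG(u)[w₁ + w₂] = DG(u)[w₁] + DG(u)[w₂]` (`Torus.leray_linearisation_add_apply`): `div`, `Δ⁻¹`, `∇`, `Δ` and `(·∇)·` are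
linear (Robinson–Rodrigo–Sadowski 2016, Thm. 2.6: `P` is a linear projection).  This is the additivity of the candidate
mixed derivative `h ↦ DG(u)[w_h]` of the smooth model of the NS semiflow (its real-linearity then follows from continuity).

## References

* J. C. Robinson, J. L. Rodrigo, W. Sadowski, *The Three-Dimensional Navier–Stokes Equations*, CUP 2016, Thm. 2.6,
  Lemma 2.9. [RobinsonRodrigoSadowskiCUP2016]
-/

noncomputable section

open _root_.MeasureTheory Set Filter Function UnitAddTorus
open scoped InnerProductSpace ContDiff Topology BigOperators

namespace Literature.Analysis.FluidPDE

namespace Torus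

open Literature.Analysis.FunctionSpaces Literature.Analysis.FunctionSpaces.Torus

variable {d : Type*} [Fintype d] [DecidableEq d]

/-- **`P` is additive**: `P(A + B) x = P A x + P B x` for smooth `A, B` (`P v = v − ∇Δ⁻¹div v`; linearity of `div`, `Δ⁻¹`,
`∇`, through `Torus.sub_gradient_invLaplacian_divergence_sub`). [cite: RobinsonRodrigoSadowskiCUP2016, Thm. 2.6 (pp. 43–44)] -/
theorem leray_add_apply {A B : UnitAddTorus d → EuclideanSpace ℝ d} (hA : IsSmooth A) (hB : IsSmooth B) (x : UnitAddTorus d) :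
    ((A x + B x) - Torus.gradient (invLaplacian (divergence fun y => A y + B y)) x) =
      (A x - Torus.gradient (invLaplacian (divergence A)) x) + (B x - Torus.gradient (invLaplacian (divergence B)) x) := by
  have hAB : IsSmooth (fun y => A y + B y) := hA.add hB
  have h := sub_gradient_invLaplacian_divergence_sub hAB hB x
  have hfun : ((fun y => A y + B y) - B) = A := by
    funext y
    simp
  rw [hfun] at h
  -- `h : P(A + B) x − P B x = P A x`
  exact (sub_eq_iff_eq_add.1 h)

/-- **The linearisation is additive in `w`**: `DG(u)[w₁ + w₂] x = DG(u)[w₁] x + DG(u)[w₂] x`,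
`DG(u)[w] = P(νΔw − (u·∇)w − (w·∇)u)`, for smooth `u, w₁, w₂`. [cite: RobinsonRodrigoSadowskiCUP2016, Thm. 2.6 (pp. 43–44)] -/
theorem leray_linearisation_add_apply (ν : ℝ) {u w₁ w₂ : UnitAddTorus d → EuclideanSpace ℝ d} (hu : IsSmooth u)
    (hw₁ : IsSmooth w₁) (hw₂ : IsSmooth w₂) (x : UnitAddTorus d) :
    ((ν • laplacian (fun z => w₁ z + w₂ z) x - (convect u (fun z => w₁ z + w₂ z) x + convect (fun z => w₁ z + w₂ z) u x)) -
        Torus.gradient (invLaplacian (divergence fun y => ν • laplacian (fun z => w₁ z + w₂ z) y -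
          (convect u (fun z => w₁ z + w₂ z) y + convect (fun z => w₁ z + w₂ z) u y))) x) =
      ((ν • laplacian w₁ x - (convect u w₁ x + convect w₁ u x)) -
          Torus.gradient (invLaplacian (divergence fun y => ν • laplacian w₁ y - (convect u w₁ y + convect w₁ u y))) x) +
        ((ν • laplacian w₂ x - (convect u w₂ x + convect w₂ u x)) -
          Torus.gradient (invLaplacian (divergence fun y => ν • laplacian w₂ y - (convect u w₂ y + convect w₂ u y))) x) := by
  have hY₁ : IsSmooth (fun y => ν • laplacian w₁ y - (convect u w₁ y + convect w₁ u y)) :=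
    (hw₁.laplacian.smul ν).sub ((hu.convect hw₁).add (hw₁.convect hu))
  have hY₂ : IsSmooth (fun y => ν • laplacian w₂ y - (convect u w₂ y + convect w₂ u y)) :=
    (hw₂.laplacian.smul ν).sub ((hu.convect hw₂).add (hw₂.convect hu))
  -- the unprojected field is additive in `w`
  have hpt : ∀ y, ν • laplacian (fun z => w₁ z + w₂ z) y - (convect u (fun z => w₁ z + w₂ z) y + convect (fun z => w₁ z + w₂ z) u y) =
      (ν • laplacian w₁ y - (convect u w₁ y + convect w₁ u y)) + (ν • laplacian w₂ y - (convect u w₂ y + convect w₂ u y)) := by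
    intro y
    have hL : laplacian (fun z => w₁ z + w₂ z) y = laplacian w₁ y + laplacian w₂ y := by
      rw [show (fun z => w₁ z + w₂ z) = w₁ + w₂ from rfl, laplacian_add_apply hw₁ hw₂]
    have hC1 : convect u (fun z => w₁ z + w₂ z) y = convect u w₁ y + convect u w₂ y := by
      rw [show (fun z => w₁ z + w₂ z) = w₁ + w₂ from rfl]
      simp only [convect, Torus.fderiv_add (hw₁.isContDiff (by simp)) (hw₂.isContDiff (by simp)) y,
        FunLike.coe_add, Pi.add_apply]
    have hC2 : convect (fun z => w₁ z + w₂ z) u y = convect w₁ u y + convect w₂ u y := by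
      simp only [convect, map_add]
    rw [hL, hC1, hC2, smul_add]
    abel
  have hfun : (fun y => ν • laplacian (fun z => w₁ z + w₂ z) y -
      (convect u (fun z => w₁ z + w₂ z) y + convect (fun z => w₁ z + w₂ z) u y)) =
      fun y => (ν • laplacian w₁ y - (convect u w₁ y + convect w₁ u y)) + (ν • laplacian w₂ y - (convect u w₂ y + convect w₂ u y)) :=
    funext hpt
  rw [hpt x, hfun]
  exact leray_add_apply hY₁ hY₂ x

end Torus

end Literature.Analysis.FluidPDE

end
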